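import Literature.NumberTheory.LFunctions.KeiperLiTrendAsymptoticProofs
import Literature.NumberTheory.LFunctions.KeiperPowerSeriesProofs
import HarnessLib

/-!
# Arias de Reyna 2011: the `ℓ²` form of the Keiper–Li asymptotics (`A_n`, Thms 4.1–4.3)

LINE 1 — LABEL: RH-FREE corpus typing (cell `rh-crit/dbl`, NODES row AdR11, lineage t13 = S18/S20
Keiper–Li asymptotic criteria) with ONE RH-CONSEQUENCE named fact (`AriasDeReyna2011_cor31`) and the
RH-EQUIVALENT criteria of the paper typed as THEOREMS CONDITIONAL on that fact; every other declaration is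
an RH-FREE definition or a PROVED identity.  bears_on: LADDER-RH L-C/L-P (COLUMN 4 LI).  WHAT THIS IS NOT:
an `ℓ²` reformulation of the Keiper–Li asymptotics fixes WHICH square-summability statement is equivalent
to RH and proves nothing toward it; no side of any equivalence is asserted; nothing here bears on the
truth of RH.

Source: J. Arias de Reyna, *Asymptotics of Keiper–Li coefficients*, Funct. Approx. Comment. Math. 45
(2011) 7–21 [AriasDeReyna2011KeiperLi] (held: `paper:reyna2011-asymptotics-keiper-li-coefficients`).
Notation of the paper = Keiper's: `λ_m = λ^K_m = λ^L_m / m` (tree `keiperLambdaK`), `γ` Euler's constant.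

## What is typed (source item → Lean → status)

* eq. (4) p.8, the numbers `A_n`: `log{(s−1)ζ(s)} = Σ_{n≥0} A_n (1 − 1/s)^n` → `ariasA` (DEFINITION: the
  Taylor coefficients at `z = 0` of `z ↦ log ζ₁(1/(1−z))`, `ζ₁(s) = (s−1)ζ(s)` Mathlib's `riemannZeta₁`,
  `1/(1−z)` the tree's `liMap`) + `AriasDeReyna2011_eq4` (PROVED: the expansion holds for `s` near `1`).
  SCOPE NOTE (E1): the printed range «`Re s > 1`» is loose — the series in `z = 1 − 1/s` has radius `1`
  iff RH (Thm 4.3); unconditionally it represents `log ζ₁` on a neighbourhood of `s = 1`, which is all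
  the paper uses (§4: «any holomorphic function on the half plane can be represented by a power series in
  `z` with radius `≥ 1`»; proof of Thm 4.3).
* the dictionary `A_n = λ̃_n / n` (`n ≥ 1`), `λ̃_n = liOscPart n` Maślanka's / Bombieri–Lagarias'
  oscillating part `(1/Γ(n)) dⁿ/dsⁿ[s^{n−1} log ζ₁(s)]_{s=1}` → `ariasA_eq_liOscPart_div` (PROVED, tree
  `keiperLiOsc_eq_iteratedDeriv` + Li's change of variables `iteratedDeriv_pow_mul_eq_iteratedDeriv_comp_liMap`).
* Thm 4.1 p.12 → `AriasDeReyna2011_thm41` (PROVED from the arithmetic formula `Coffey2005_thm1_holds`).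
* Thm 4.2 p.15 → `AriasDeReyna2011_thm42` (PROVED).  Deviation from print, recorded: the paper gets
  `(x_m) ∈ ℓ²` from Lemma 4.1 (the Laguerre integrals `I_m` are rapidly decreasing); we get it — with the
  same `x_m`, see (17) — from the tree's all-orders trend expansion `Voros2006_eqTS_holds`
  (`liTrend n = (n/2)(H_n − 1 − log 2π) + ½ + o(n^{−N})`) and `0 < H_m − log m − γ ≤ 1/m`; in fact
  `x_m = O(1/m)` (`AriasDeReyna2011.isBigO_xSeq`).
* Lemma 4.1 p.13, SECOND clause («`(I_m)` is rapidly decreasing: `m^k I_m → 0` for all `k`») →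
  `AriasDeReyna2011_lemma41_rapid` (PROVED), with `I_m` READ ON eq. (14) (`ariasI`; `I_m = −2ε_m`,
  `AriasDeReyna2011.ariasI_eq`, `ε_m` the trend remainder of `Voros2006_eqTS`).
* Cor 3.1 p.11 (RH ⟹ `λ_m = ½ log m − ½(log 2π + 1 − γ) + y_m`, `(y_m) ∈ ℓ²`) → NAMED FACT
  `AriasDeReyna2011_cor31` (RH-CONSEQUENCE; it is Thm 3.1 — stated in full in the docstring — applied to
  the ordinates of the zeros under RH with `S(t) = O(log t)`; not proved here).
* Thm 4.3 p.15 (RH ⟺ `(A_n) ∈ ℓ²`) → `AriasDeReyna2011_thm43_mpr` (PROVED, RH-FREE: `(A_n) ∈ ℓ² ⟹ RH`,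
  the printed argument: radius `≥ 1` ⟹ `log ζ₁` holomorphic on `Re s > ½`) and
  `AriasDeReyna2011_thm43_of_cor31` (PROVED modulo the fact: the equivalence).
* Main theorem (abstract and §1 p.8: RH ⟺ `(y_m) ∈ ℓ²`, `y_m := λ_m − ½ log m + ½(log 2π + 1 − γ)`) →
  `AriasDeReyna2011_thm_main_mpr` (PROVED, RH-FREE) and `AriasDeReyna2011_thm_main_of_cor31` (PROVED
  modulo the fact).
* NOT TYPED (recorded): Thm 3.1 p.9 in its general form (arbitrary non-decreasing sequences `(γ_j)` with
  `N(t) = (t/2π)log(t/2π) − t/2π + O(log t)`) — `-- TODO(general form)`, only its corollary 3.1 is used;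
  Lemma 4.1 p.13 FIRST clause = the Laguerre-integral definition (13) of `I_m` (no Laguerre
  polynomials in Mathlib; `I_m` is DEFINED by (14) instead); §5 (Prop 5.1, Thm 5.1 `A_n = ∫₀^∞ {Π(eᵗ) −
  Li(eᵗ)} L_n(t) e^{−t} dt`, Cor 5.1 = [Arias de Reyna 2008] RH ⟺ `(Π(x) − Li(x))/x ∈ L²(1,∞)`, Thm 5.2)
  — Laguerre moments again; §6 remarks and figures.
* `ℓ²` is typed as `Summable (fun m ↦ (u m)^2)` for real sequences (= `Memℓp u 2`).

## References

* [AriasDeReyna2011KeiperLi] J. Arias de Reyna, Funct. Approx. Comment. Math. 45 (2011) 7–21,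
  doi:10.7169/facm/1317045228.
* [Keiper1992] J. B. Keiper, Math. Comp. 58 (1992) 765–773.
* [Voros2006] A. Voros, Math. Phys. Anal. Geom. 9 (2006) 53–63.
* [BombieriLagarias1999] E. Bombieri, J. C. Lagarias, J. Number Theory 77 (1999) 274–287.
-/

noncomputable section

open Filter Topology Finset Asymptotics
open scoped Nat ComplexConjugate

namespace Literature.NumberTheory.LFunctions

/-! ## Eq. (4): the coefficients `A_n` -/

/-- RH-FREE (definition). **Arias de Reyna's `A_n`** ([AriasDeReyna2011KeiperLi] eq. (4) p.8): the
coefficients of `log{(s−1)ζ(s)} = Σ_{n≥0} A_n (1 − 1/s)^n`, i.e. the Taylor coefficients at `z = 0` of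
`z ↦ log ζ₁(1/(1−z))` (`ζ₁(s) = (s−1)ζ(s)`, principal logarithm, `ζ₁(1) = 1`); real numbers
(`ariasA_coe`).  `A_0 = 0`, `A_1 = γ` ((22)–(23)). [cite: AriasDeReyna2011KeiperLi, eq. (4) p.8] -/
def ariasA (n : ℕ) : ℝ :=
  (iteratedDeriv n (fun z ↦ Complex.log (riemannZeta₁ (liMap z))) 0 / (n ! : ℂ)).re

namespace AriasDeReyna2011

/-- `log ζ₁` is analytic at `1` (`ζ₁(1) = 1`). [folklore] -/
private theorem analyticAt_logZetaOne_one : AnalyticAt ℂ (fun s ↦ Complex.log (riemannZeta₁ s)) 1 :=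
  (differentiable_riemannZeta₁.analyticAt 1).clog (by
    rw [riemannZeta₁_one]; exact Complex.one_mem_slitPlane)

/-- `z ↦ log ζ₁(1/(1−z))` is analytic at `0`. [folklore] -/
private theorem analyticAt_logZetaOne_liMap_zero :
    AnalyticAt ℂ (fun z ↦ Complex.log (riemannZeta₁ (liMap z))) 0 := by
  have h : AnalyticAt ℂ (fun s ↦ Complex.log (riemannZeta₁ s)) (liMap 0) := by
    rw [liMap_zero]; exact analyticAt_logZetaOne_one
  exact h.comp (analyticAt_liMap zero_ne_one)

/-- `ζ₁(s̄) = conj ζ₁(s)`. [folklore] -/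
private theorem riemannZeta₁_conj (s : ℂ) : riemannZeta₁ (conj s) = conj (riemannZeta₁ s) := by
  by_cases hs : s = 1
  · subst hs; simp [riemannZeta₁_one]
  have hs' : conj s ≠ 1 := by
    intro h; apply hs; simpa using congrArg conj h
  rw [riemannZeta₁_eq_mul hs', riemannZeta₁_eq_mul hs, map_mul, map_sub, map_one, riemannZeta_conj]

/-- `liMap (conj z) = conj (liMap z)`. [folklore] -/
private theorem liMap_conj' (z : ℂ) : liMap (conj z) = conj (liMap z) := by
  simp [liMap, map_sub, map_inv₀]

/-- `(s ↦ conj k(conj s))^{(n)}(z) = conj (k^{(n)}(conj z))`, unconditionally (as in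
`KeiperPowerSeries.lean`, where it is private). [folklore] -/
private theorem iteratedDeriv_conj_conj (k : ℂ → ℂ) (n : ℕ) (z : ℂ) :
    iteratedDeriv n (fun s ↦ conj (k (conj s))) z = conj (iteratedDeriv n k (conj z)) := by
  induction n generalizing z with
  | zero => simp
  | succ n ih =>
    have e : iteratedDeriv n (fun s ↦ conj (k (conj s))) = fun s ↦ conj (iteratedDeriv n k (conj s)) :=
      funext ih
    rw [iteratedDeriv_succ, e, iteratedDeriv_succ]
    set g := iteratedDeriv n k
    by_cases h : DifferentiableAt ℂ g (conj z)
    · have h1 := h.hasDerivAt.conj_conj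
      rw [Complex.conj_conj] at h1
      exact h1.deriv
    · have h2 : ¬DifferentiableAt ℂ (fun s ↦ conj (g (conj s))) z := by
        intro hd
        have h3 := hd.hasDerivAt.conj_conj
        have hg : (conj ∘ (fun s ↦ conj (g (conj s))) ∘ conj) = g := by funext s; simp
        rw [hg] at h3
        exact h h3.differentiableAt
      rw [deriv_zero_of_not_differentiableAt h, deriv_zero_of_not_differentiableAt h2, map_zero]

/-- If `F(conj z) = conj F(z)` for `z` near the real point `x`, every `F^{(n)}(x)` is real (as in
`KeiperPowerSeries.lean`, where it is private). [folklore] -/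
private theorem im_iteratedDeriv_eq_zero_of_eventually_conj {F : ℂ → ℂ} {x : ℝ}
    (h : ∀ᶠ z in 𝓝 (x : ℂ), F (conj z) = conj (F z)) (n : ℕ) :
    (iteratedDeriv n F x).im = 0 := by
  have hG : (fun s ↦ conj (F (conj s))) =ᶠ[𝓝 (x : ℂ)] F := by
    have hc : Tendsto (fun z : ℂ ↦ conj z) (𝓝 (x : ℂ)) (𝓝 (x : ℂ)) := by
      have := (Complex.continuous_conj.tendsto (x : ℂ))
      rwa [Complex.conj_ofReal] at this
    filter_upwards [hc.eventually h] with z hz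
    rw [Complex.conj_conj] at hz
    exact hz.symm
  have e := hG.iteratedDeriv_eq n
  rw [iteratedDeriv_conj_conj, Complex.conj_ofReal] at e
  exact Complex.conj_eq_iff_im.1 e

/-- `log ζ₁(1/(1−z̄)) = conj log ζ₁(1/(1−z))` near `z = 0` (`ζ₁(1) = 1` is off the cut). [folklore] -/
private theorem logZetaOne_liMap_conj_eventually :
    ∀ᶠ z in 𝓝 ((0 : ℝ) : ℂ), Complex.log (riemannZeta₁ (liMap (conj z))) =
      conj (Complex.log (riemannZeta₁ (liMap z))) := by
  have hc : ContinuousAt (fun z ↦ riemannZeta₁ (liMap z)) 0 :=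
    (differentiable_riemannZeta₁.continuous.continuousAt).comp
      (f := liMap) (analyticAt_liMap zero_ne_one).continuousAt
  have hne : ∀ᶠ z in 𝓝 (0 : ℂ), riemannZeta₁ (liMap z) ∈ Complex.slitPlane := by
    refine hc.eventually_mem (Complex.isOpen_slitPlane.mem_nhds ?_)
    rw [liMap_zero, riemannZeta₁_one]; exact Complex.one_mem_slitPlane
  rw [Complex.ofReal_zero]
  filter_upwards [hne] with z hz
  rw [liMap_conj', riemannZeta₁_conj, Complex.log_conj_eq_ite,
    if_neg (Complex.mem_slitPlane_iff_arg.1 hz).1]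

/-- The Taylor coefficients of `log ζ₁(1/(1−z))` at `0` are real. [cite: AriasDeReyna2011KeiperLi, eq. (4) p.8] -/
theorem im_iteratedDeriv_logZetaOne_liMap_zero (n : ℕ) :
    (iteratedDeriv n (fun z ↦ Complex.log (riemannZeta₁ (liMap z))) 0).im = 0 := by
  have := im_iteratedDeriv_eq_zero_of_eventually_conj
    (F := fun z ↦ Complex.log (riemannZeta₁ (liMap z))) (x := 0) logZetaOne_liMap_conj_eventually n
  simpa using this

end AriasDeReyna2011

/-- RH-FREE. `A_n` as a complex number IS the `n`-th Taylor coefficient of `log ζ₁(1/(1−z))` at `0`.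
[cite: AriasDeReyna2011KeiperLi, eq. (4) p.8] -/
theorem ariasA_coe (n : ℕ) :
    (ariasA n : ℂ) = iteratedDeriv n (fun z ↦ Complex.log (riemannZeta₁ (liMap z))) 0 / (n ! : ℂ) := by
  rw [ariasA]
  apply Complex.ext
  · simp
  · rw [Complex.ofReal_im, Complex.div_natCast_im, AriasDeReyna2011.im_iteratedDeriv_logZetaOne_liMap_zero,
      zero_div]

/-- RH-FREE. `A_0 = log ζ₁(1) = 0` ([AriasDeReyna2011KeiperLi] (22)). [cite: AriasDeReyna2011KeiperLi, eq. (22) p.17] -/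
theorem ariasA_zero : ariasA 0 = 0 := by
  simp [ariasA, riemannZeta₁_one]

/-- RH-FREE, PROVED — **[AriasDeReyna2011KeiperLi] eq. (4) p.8**: `log{(s−1)ζ(s)} = Σ_{n≥0} A_n (1 − 1/s)^n`
for `s` near `1` (principal `log` of `ζ₁(s) = (s−1)ζ(s)`, `= 0` at `s = 1`).  See the module doc (E1) for
the printed range «`Re s > 1`». [cite: AriasDeReyna2011KeiperLi, eq. (4) p.8] -/
theorem AriasDeReyna2011_eq4 :
    ∀ᶠ s in 𝓝 (1 : ℂ), HasSum (fun n ↦ (ariasA n : ℂ) * (1 - 1 / s) ^ n)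
      (Complex.log (riemannZeta₁ s)) := by
  obtain ⟨r, hr0, hr⟩ := Metric.isOpen_iff.1
    (isOpen_analyticAt ℂ (fun z ↦ Complex.log (riemannZeta₁ (liMap z)))) 0
    AriasDeReyna2011.analyticAt_logZetaOne_liMap_zero
  have hd : DifferentiableOn ℂ (fun z ↦ Complex.log (riemannZeta₁ (liMap z))) (Metric.ball 0 r) :=
    fun z hz ↦ (hr hz).differentiableAt.differentiableWithinAt
  -- `s ↦ 1 − 1/s` is continuous at `1` with value `0`
  have hc : Tendsto (fun s : ℂ ↦ 1 - 1 / s) (𝓝 1) (𝓝 0) := by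
    have h1 : ContinuousAt (fun s : ℂ ↦ 1 - 1 / s) 1 :=
      continuousAt_const.sub ((continuousAt_const.div continuousAt_id one_ne_zero))
    have := h1.tendsto
    simpa using this
  filter_upwards [hc (Metric.ball_mem_nhds (0 : ℂ) hr0)] with s hs
  have hT := Complex.hasSum_taylorSeries_on_ball hd hs
  have e : liMap (1 - 1 / s) = s := by rw [one_div, liMap_one_sub, inv_inv]
  simp only [e] at hT
  refine hT.congr_fun fun n ↦ ?_
  rw [ariasA_coe, smul_eq_mul, smul_eq_mul, sub_zero]
  ring

/-- RH-FREE, PROVED — the dictionary **`A_n = λ̃_n / n`** (`n ≥ 1`): Arias de Reyna's `A_n` is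
Maślanka's / Bombieri–Lagarias' OSCILLATING PART `λ̃_n = liOscPart n = (1/Γ(n)) dⁿ/dsⁿ[s^{n−1} log ζ₁(s)]_{s=1}
= −Σ_{j=1}^n C(n,j) η_{j−1}` divided by `n` (Li's change of variables `dⁿ/dsⁿ[s^{n−1}G]_{s=1} =
dⁿ/dzⁿ[G(1/(1−z))]_{z=0}`, tree `iteratedDeriv_pow_mul_eq_iteratedDeriv_comp_liMap`, and
`keiperLiOsc_eq_iteratedDeriv`).  This is the content of the computation (4) → (12) of the paper
(`A_m = Σ_j M_j C(m−1, j−1)`). [cite: AriasDeReyna2011KeiperLi, proof of Thm 4.1 p.12] -/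
theorem ariasA_eq_liOscPart_div {n : ℕ} (hn : 1 ≤ n) : ariasA n = liOscPart n / n := by
  rw [liOscPart_eq_sum_zetaOneLogDerivCoeff, keiperLiOsc_eq_iteratedDeriv hn, ariasA,
    iteratedDeriv_pow_mul_eq_iteratedDeriv_comp_liMap n AriasDeReyna2011.analyticAt_logZetaOne_one]
  have e : ((fun s ↦ Complex.log (riemannZeta₁ s)) ∘ liMap) =
      fun z ↦ Complex.log (riemannZeta₁ (liMap z)) := rfl
  rw [e]
  set D := iteratedDeriv n (fun z ↦ Complex.log (riemannZeta₁ (liMap z))) 0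
  have hfac : (n ! : ℂ) = (n : ℂ) * ((n - 1)! : ℂ) := by
    exact_mod_cast (Nat.mul_factorial_pred (by omega : n ≠ 0)).symm
  rw [hfac, mul_comm, ← div_div, Complex.div_natCast_re]

/-- RH-FREE, PROVED — `A_1 = γ` ([AriasDeReyna2011KeiperLi] (23); `λ̃_1 = −η_0 = γ`, Keiper's (46) `q_0 = γ`).
[cite: AriasDeReyna2011KeiperLi, eq. (23) p.17] -/
theorem ariasA_one : ariasA 1 = Real.eulerMascheroniConstant := by
  rw [ariasA_eq_liOscPart_div le_rfl, liOscPart_eq_sum_zetaOneLogDerivCoeff, Finset.sum_range_one,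
    Keiper1992_eq46.1]
  simp

/-! ## Theorem 4.1: `A_m` versus `λ_m` -/

/-- RH-FREE, PROVED — **[AriasDeReyna2011KeiperLi] Theorem 4.1 p.12**: for `m ≥ 1`,
`A_m = λ_m + (γ + log 4π)/2 − 1/m − (1/m) Σ_{j=2}^m (−1)^j C(m,j) (1 − 2^{−j}) ζ(j)`
(«when `m = 1`, the sum must be taken as equal to `0`» — it is empty), `λ_m` Keiper's (`keiperLambdaK`).
Printed proof: Keiper's (46) and (27) re-expanded in `z = 1 − 1/s`, and `σ₁ = 1 + γ/2 − ½log π − log 2` (7).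
Here: `A_m = λ̃_m/m` (`ariasA_eq_liOscPart_div`) and the arithmetic formula `λ^L_m = λ̄_m + λ̃_m` with
`λ̄_m = 1 − (log 4π + γ)m/2 + Σ_{j=2}^m (−1)^j C(m,j)(1−2^{−j})ζ(j)` (tree `Coffey2005_thm1_holds`,
Bombieri–Lagarias Thm 2). [cite: AriasDeReyna2011KeiperLi, Theorem 4.1 p.12] -/
theorem AriasDeReyna2011_thm41 {m : ℕ} (hm : 1 ≤ m) :
    ariasA m = keiperLambdaK m + (Real.eulerMascheroniConstant + Real.log (4 * Real.pi)) / 2 - 1 / m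
      - 1 / m * ∑ j ∈ Icc 2 m,
        (-1 : ℝ) ^ j * (m.choose j : ℝ) * (1 - 1 / 2 ^ j) * (riemannZeta j).re := by
  rw [ariasA_eq_liOscPart_div hm, keiperLambdaK]
  have h := (Coffey2005_thm1_holds).2 m hm
  rw [liTrend_eq, liArchPart_eq, liArchSum] at h
  have hlog : Real.log (4 * Real.pi) = 2 * Real.log 2 + Real.log Real.pi := by
    rw [Real.log_mul (by norm_num) Real.pi_pos.ne', show (4 : ℝ) = 2 ^ 2 by norm_num, Real.log_pow]
    push_cast
    ring
  have hsum : ∑ j ∈ Icc 2 m, (-1 : ℝ) ^ j * (m.choose j : ℝ) * (1 - 1 / 2 ^ j) * (riemannZeta j).re =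
      ∑ j ∈ Icc 2 m, (-1 : ℝ) ^ j * (m.choose j : ℝ) * (1 - (2 : ℝ)⁻¹ ^ j) * (riemannZeta j).re := by
    refine Finset.sum_congr rfl fun j _ ↦ ?_
    rw [inv_pow, one_div]
  rw [hsum, hlog, h]
  set S := ∑ j ∈ Icc 2 m, (-1 : ℝ) ^ j * (m.choose j : ℝ) * (1 - (2 : ℝ)⁻¹ ^ j) * (riemannZeta j).re
  have hm0 : (m : ℝ) ≠ 0 := by exact_mod_cast (by omega : m ≠ 0)
  field_simp
  ring

/-! ## Theorem 4.2: `A_m = λ_m − ½ log m + ½(log 2π + 1 − γ) + x_m`, `(x_m) ∈ ℓ²` -/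

namespace AriasDeReyna2011

/-- The sequence `x_m` of [AriasDeReyna2011KeiperLi] Thm 4.2 / eq. (17):
`x_m := A_m − λ_m + ½ log m − ½(log 2π + 1 − γ)`. [cite: AriasDeReyna2011KeiperLi, eq. (17) p.15] -/
def xSeq (m : ℕ) : ℝ :=
  ariasA m - keiperLambdaK m + Real.log m / 2 -
    (Real.log (2 * Real.pi) + 1 - Real.eulerMascheroniConstant) / 2

/-- `x_m` in closed form ((17) p.15 with the Laguerre remainder `I_m/2m` written as `−ε_m/m`,
`ε_m := λ̄_m − [(m/2)(H_m − 1 − log 2π) + ½]` the trend remainder of `Voros2006_eqTS`):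
`x_m = −½(H_m − log m − γ) − 1/(2m) − ε_m/m` for `m ≥ 1`. [cite: AriasDeReyna2011KeiperLi, eq. (17) p.15] -/
theorem xSeq_eq {m : ℕ} (hm : 1 ≤ m) :
    xSeq m = -(1 / 2) * ((harmonic m : ℝ) - Real.log m - Real.eulerMascheroniConstant) - 1 / (2 * m)
      - (liTrend m - ((m : ℝ) / 2 * ((harmonic m : ℝ) - 1 - Real.log (2 * Real.pi)) + 1 / 2)) / m := by
  rw [xSeq, ariasA_eq_liOscPart_div hm, keiperLambdaK, (Coffey2005_thm1_holds).2 m hm]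
  have hm0 : (m : ℝ) ≠ 0 := by exact_mod_cast (by omega : m ≠ 0)
  field_simp
  ring

/-- `0 ≤ H_m − log m − γ ≤ 1/m` for `m ≥ 1` (Mathlib's monotone Euler–Mascheroni sequences).
[folklore] -/
private theorem abs_harmonic_sub_log_sub_eulerMascheroni_le {m : ℕ} (hm : 1 ≤ m) :
    |(harmonic m : ℝ) - Real.log m - Real.eulerMascheroniConstant| ≤ 1 / m := by
  have h1 := Real.eulerMascheroniConstant_lt_eulerMascheroniSeq' m
  rw [Real.eulerMascheroniSeq', if_neg (by omega : m ≠ 0)] at h1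
  have h2 := Real.eulerMascheroniSeq_lt_eulerMascheroniConstant m
  rw [Real.eulerMascheroniSeq] at h2
  have hm' : (0 : ℝ) < m := by exact_mod_cast (by omega : 0 < m)
  have hlog : Real.log ((m : ℝ) + 1) - Real.log m ≤ 1 / m := by
    rw [← Real.log_div (by positivity) hm'.ne']
    have := Real.log_le_sub_one_of_pos (x := ((m : ℝ) + 1) / m) (by positivity)
    rw [show ((m : ℝ) + 1) / m - 1 = 1 / m by field_simp; ring] at this
    exact this
  rw [abs_le]
  constructor <;> linarith

/-- `x_m = O(1/m)` (sharper than the printed `(x_m) ∈ ℓ²`). [cite: AriasDeReyna2011KeiperLi, Theorem 4.2 p.15] -/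
theorem isBigO_xSeq : xSeq =O[atTop] (fun m : ℕ ↦ (m : ℝ)⁻¹) := by
  -- the three pieces of `xSeq_eq`
  have hε : (fun m : ℕ ↦ liTrend m - ((m : ℝ) / 2 * ((harmonic m : ℝ) - 1 - Real.log (2 * Real.pi)) + 1 / 2))
      =O[atTop] (fun m : ℕ ↦ (m : ℝ)⁻¹) := by
    have h := (Voros2006_eqTS_holds 1).isBigO
    refine h.trans ?_
    refine (isBigO_refl _ _).congr' ?_ EventuallyEq.rfl
    filter_upwards with m
    simp
  have h3 : (fun m : ℕ ↦ (liTrend m - ((m : ℝ) / 2 * ((harmonic m : ℝ) - 1 - Real.log (2 * Real.pi)) + 1 / 2)) / m)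
      =O[atTop] (fun m : ℕ ↦ (m : ℝ)⁻¹) := by
    refine (IsBigO.of_bound 1 ?_).trans hε
    filter_upwards [eventually_ge_atTop 1] with m hm
    have hm' : (1 : ℝ) ≤ m := by exact_mod_cast hm
    rw [Real.norm_eq_abs, Real.norm_eq_abs, abs_div, Nat.abs_cast, one_mul]
    exact div_le_self (abs_nonneg _) hm'
  have h1 : (fun m : ℕ ↦ -(1 / 2) * ((harmonic m : ℝ) - Real.log m - Real.eulerMascheroniConstant))
      =O[atTop] (fun m : ℕ ↦ (m : ℝ)⁻¹) := by
    refine IsBigO.of_bound (1 / 2) ?_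
    filter_upwards [eventually_ge_atTop 1] with m hm
    have hm' : (0 : ℝ) < m := by exact_mod_cast (by omega : 0 < m)
    rw [Real.norm_eq_abs, Real.norm_eq_abs, abs_mul, abs_inv, Nat.abs_cast]
    have := abs_harmonic_sub_log_sub_eulerMascheroni_le hm
    rw [one_div] at this
    have e : |(-(1 / 2) : ℝ)| = 1 / 2 := by norm_num
    rw [e]
    nlinarith [abs_nonneg ((harmonic m : ℝ) - Real.log m - Real.eulerMascheroniConstant)]
  have h2 : (fun m : ℕ ↦ (1 : ℝ) / (2 * m)) =O[atTop] (fun m : ℕ ↦ (m : ℝ)⁻¹) := by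
    refine IsBigO.of_bound (1 / 2) ?_
    filter_upwards [eventually_ge_atTop 1] with m hm
    have hm' : (0 : ℝ) < m := by exact_mod_cast (by omega : 0 < m)
    rw [Real.norm_eq_abs, Real.norm_eq_abs, abs_inv, Nat.abs_cast,
      abs_of_pos (by positivity : (0 : ℝ) < 1 / (2 * m))]
    rw [show (1 : ℝ) / (2 * m) = 1 / 2 * (m : ℝ)⁻¹ by field_simp]
  have h := (h1.sub h2).sub h3
  refine h.congr' ?_ EventuallyEq.rfl
  filter_upwards [eventually_ge_atTop 1] with m hm
  rw [xSeq_eq hm]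

/-- `(x_m) ∈ ℓ²`. [cite: AriasDeReyna2011KeiperLi, Theorem 4.2 p.15] -/
theorem summable_xSeq_sq : Summable (fun m : ℕ ↦ xSeq m ^ 2) := by
  have h2 : (fun m : ℕ ↦ xSeq m ^ 2) =O[atTop] (fun m : ℕ ↦ ((m : ℝ) ^ 2)⁻¹) := by
    have := isBigO_xSeq.pow 2
    refine this.congr' EventuallyEq.rfl ?_
    filter_upwards with m
    rw [inv_pow]
  refine summable_of_isBigO_nat ?_ h2
  exact Real.summable_nat_pow_inv.2 one_lt_two

end AriasDeReyna2011

/-- RH-FREE, PROVED — **[AriasDeReyna2011KeiperLi] Theorem 4.2 p.15**: «There exists `(x_m) ∈ ℓ²` such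
that for every natural number `m`, `A_m = λ_m − (log m)/2 + (log 2π + 1 − γ)/2 + x_m`.»  (`ℓ²` typed as
square-summable; the witness is `AriasDeReyna2011.xSeq`, in fact `O(1/m)`; at `m = 0` all of `A_0`,
`λ_0`, `log 0` are `0` and `x_0` is the constant.)  Printed proof via Lemma 4.1 (Laguerre integrals);
here via the all-orders trend expansion `Voros2006_eqTS_holds` — see the module doc.
[cite: AriasDeReyna2011KeiperLi, Theorem 4.2 p.15] -/
theorem AriasDeReyna2011_thm42 :
    ∃ x : ℕ → ℝ, Summable (fun m ↦ x m ^ 2) ∧ ∀ m : ℕ,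
      ariasA m = keiperLambdaK m - Real.log m / 2 +
        (Real.log (2 * Real.pi) + 1 - Real.eulerMascheroniConstant) / 2 + x m :=
  ⟨AriasDeReyna2011.xSeq, AriasDeReyna2011.summable_xSeq_sq, fun m ↦ by
    rw [AriasDeReyna2011.xSeq]; ring⟩

/-! ## Lemma 4.1 (the remainder `I_m`, read on (14)): rapid decrease -/

/-- RH-FREE (definition). **Arias de Reyna's `I_m`, READ ON eq. (14)** ([AriasDeReyna2011KeiperLi] Lemma
4.1 p.13): `I_m := m(log 2 + γ + Σ_{j=2}^{m−1} 1/j) − 2 Σ_{j=2}^m (−1)^j C(m,j)(1 − 2^{−j}) ζ(j)`.  In print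
`I_m` is DEFINED by the Laguerre integral (13) `∫₀^∞ L_m(t)(e^{−t}/t² + e^{−t}/t − cosh t/sinh²t) dt` and (14)
is the first clause of Lemma 4.1; the tree has no Laguerre polynomials, so (14) is taken as the
definition and (13) is NOT typed (`-- TODO(general form): I_m = ∫₀^∞ L_m(t)(…) dt`, eq. (13)).
[cite: AriasDeReyna2011KeiperLi, Lemma 4.1 eq. (14) p.13] -/
def ariasI (m : ℕ) : ℝ :=
  m * (Real.log 2 + Real.eulerMascheroniConstant + ∑ j ∈ Icc 2 (m - 1), (1 : ℝ) / j) -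
    2 * ∑ j ∈ Icc 2 m, (-1 : ℝ) ^ j * (m.choose j : ℝ) * (1 - 1 / 2 ^ j) * (riemannZeta j).re

namespace AriasDeReyna2011

/-- `Σ_{j=2}^n 1/j = H_n − 1` (`n ≥ 1`). [folklore] -/
private theorem sum_Icc_two_one_div {n : ℕ} (hn : 1 ≤ n) :
    ∑ j ∈ Icc 2 n, (1 : ℝ) / j = (harmonic n : ℝ) - 1 := by
  induction n with
  | zero => omega
  | succ k ih =>
    rcases Nat.eq_zero_or_pos k with rfl | hk
    · simp
    · rw [Finset.sum_Icc_succ_top (by omega), ih hk, harmonic_succ]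
      push_cast
      ring

/-- **`I_m` is `−2×` the trend remainder**: `I_m = −2 ε_m`, `ε_m := λ̄_m − [(m/2)(H_m − 1 − log 2π) + ½]`
(`m ≥ 2`; `λ̄_m = liTrend m`).  This is (17) p.15 compared with `AriasDeReyna2011.xSeq_eq`.
[cite: AriasDeReyna2011KeiperLi, Lemma 4.1 p.13 and eq. (17) p.15] -/
theorem ariasI_eq {m : ℕ} (hm : 2 ≤ m) :
    ariasI m = -2 * (liTrend m - ((m : ℝ) / 2 * ((harmonic m : ℝ) - 1 - Real.log (2 * Real.pi)) + 1 / 2)) := by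
  rw [ariasI, liTrend_eq, liArchPart_eq, liArchSum, sum_Icc_two_one_div (by omega : 1 ≤ m - 1)]
  have hsum : ∑ j ∈ Icc 2 m, (-1 : ℝ) ^ j * (m.choose j : ℝ) * (1 - 1 / 2 ^ j) * (riemannZeta j).re =
      ∑ j ∈ Icc 2 m, (-1 : ℝ) ^ j * (m.choose j : ℝ) * (1 - (2 : ℝ)⁻¹ ^ j) * (riemannZeta j).re := by
    refine Finset.sum_congr rfl fun j _ ↦ ?_
    rw [inv_pow, one_div]
  have hH : (harmonic m : ℝ) = (harmonic (m - 1) : ℝ) + 1 / m := by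
    obtain ⟨k, rfl⟩ : ∃ k, m = k + 1 := ⟨m - 1, by omega⟩
    rw [Nat.add_sub_cancel, harmonic_succ]
    push_cast
    ring
  have hlog : Real.log (2 * Real.pi) = Real.log 2 + Real.log Real.pi :=
    Real.log_mul (by norm_num) Real.pi_pos.ne'
  rw [hsum, hH, hlog]
  set S := ∑ j ∈ Icc 2 m, (-1 : ℝ) ^ j * (m.choose j : ℝ) * (1 - (2 : ℝ)⁻¹ ^ j) * (riemannZeta j).re
  have hm0 : (m : ℝ) ≠ 0 := by exact_mod_cast (by omega : m ≠ 0)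
  field_simp
  ring

end AriasDeReyna2011

/-- RH-FREE, PROVED — **[AriasDeReyna2011KeiperLi] Lemma 4.1 p.13, second clause**: «the sequence `(I_m)`
is rapidly decreasing, that is, for all `k > 0`, we have `lim_{m→∞} m^k I_m = 0`» (`I_m` read on (14),
`ariasI`).  Printed proof: Laguerre expansions of rapidly decreasing smooth functions [Duran 1990, Thm
2.5]; here: `I_m = −2ε_m` (`AriasDeReyna2011.ariasI_eq`) and `ε_m = o(m^{−N})` for every `N`
(`Voros2006_eqTS_holds`) — the two papers' all-orders statements are the same fact.
[cite: AriasDeReyna2011KeiperLi, Lemma 4.1 p.13] -/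
theorem AriasDeReyna2011_lemma41_rapid (k : ℕ) :
    Tendsto (fun m : ℕ ↦ (m : ℝ) ^ k * ariasI m) atTop (𝓝 0) := by
  have hε := Voros2006_eqTS_holds k
  -- `m^k ε_m = o(1)`
  have h1 : (fun m : ℕ ↦ (m : ℝ) ^ k *
      (liTrend m - ((m : ℝ) / 2 * ((harmonic m : ℝ) - 1 - Real.log (2 * Real.pi)) + 1 / 2)))
      =o[atTop] (fun _ : ℕ ↦ (1 : ℝ)) := by
    have h := (isBigO_refl (fun m : ℕ ↦ (m : ℝ) ^ k) atTop).mul_isLittleO hε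
    refine h.trans_isBigO ?_
    refine IsBigO.of_bound 1 ?_
    filter_upwards [eventually_ge_atTop 1] with m hm
    have hm' : (0 : ℝ) < m := by exact_mod_cast (by omega : 0 < m)
    rw [zpow_neg, zpow_natCast, mul_inv_cancel₀ (pow_ne_zero _ hm'.ne')]
    simp
  have h2 := (isLittleO_one_iff (F := ℝ)).1 h1
  have h3 := h2.const_mul (-2)
  rw [mul_zero] at h3
  refine h3.congr' ?_
  filter_upwards [eventually_ge_atTop 2] with m hm
  rw [AriasDeReyna2011.ariasI_eq hm]
  ring

/-! ## §3: the behaviour of `λ_m` under RH (Theorem 3.1, Corollary 3.1) — the one named fact -/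

/-- RH-CONSEQUENCE NAMED FACT — **[AriasDeReyna2011KeiperLi] Corollary 3.1 p.11**: «By assuming the
Riemann Hypothesis we have `λ_m = (log m)/2 − (log(2π) + 1 − γ)/2 + y_m` where `(y_m) ∈ ℓ²`» (`λ_m`
Keiper's, `m ≥ 1`; `ℓ²` = square-summable).  It is the case `γ_j` = the positive ordinates of the zeros
(with multiplicity; under RH `λ_m = (4/m) Σ_{γ>0} sin²(m θ_γ)`, `θ_γ = arctan(1/2γ)`, p.9, and
`N(T) = (T/2π)log(T/2π) − T/2π + O(log T)`, Titchmarsh Thm 9.4) of the paper's RH-FREE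
**Theorem 3.1 p.9**: «Let `(γ_j)` be a non-decreasing sequence of positive real numbers, distributed such
that `N(t) = #{j : γ_j ≤ t} = (t/2π) log(t/2π) − t/2π + S(t)` where `S(t) = O(log t)`.  Defining
`θ_j = arctan(1/(2γ_j))`, we then have `(4/m) Σ_{j≥1} sin²(m θ_j) = (log m)/2 − (log(2π) + 1 − γ)/2 + y_m`
where `(y_m) ∈ ℓ²`» (proof pp.10–11: Stieltjes integration against `dN`, the smooth part `J₁(m)` through
`∫₀^∞ sin²x/x² dx = π/2` and `∫₀^∞ (sin²x/x²) log x dx = π(1 − γ − log 2)/2`, the part `J₂(m) =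
4∫₀^{π/2} sin(2my) S(1/(2 tan y)) dy` square-summable by Bessel's inequality since `S(1/(2 tan y)) ∈
L²(0, π/2)`).  This «confirms and sharpens» Keiper's heuristic (8) and Voros's criterion.  Not proved
here; users take `(h : AriasDeReyna2011_cor31)`.  WHAT THIS IS NOT: the hypothesis RH is not asserted;
nothing here bears on the truth of RH.
-- TODO(general form): Theorem 3.1 for arbitrary sequences `(γ_j)` as displayed above.
[cite: AriasDeReyna2011KeiperLi, Corollary 3.1 p.11 (Theorem 3.1 p.9)] -/
def AriasDeReyna2011_cor31 : Prop :=
  RiemannHypothesis → ∃ y : ℕ → ℝ, Summable (fun m ↦ y m ^ 2) ∧ ∀ m : ℕ, 1 ≤ m →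
    keiperLambdaK m = Real.log m / 2 - (Real.log (2 * Real.pi) + 1 - Real.eulerMascheroniConstant) / 2 + y m

/-! ## Theorem 4.3: RH ⟺ `(A_n) ∈ ℓ²`; the main theorem: RH ⟺ `(y_m) ∈ ℓ²` -/

namespace AriasDeReyna2011

/-- The sum of the formal series `Σ A_n zⁿ` is `Σ' A_n zⁿ`. [cite: AriasDeReyna2011KeiperLi, eq. (4) p.8] -/
theorem aSeries_sum_eq (z : ℂ) :
    (FormalMultilinearSeries.ofScalars ℂ (fun n ↦ (ariasA n : ℂ))).sum z = ∑' n, (ariasA n : ℂ) * z ^ n := by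
  have := FormalMultilinearSeries.ofScalars_sum_eq (E := ℂ) (fun n ↦ (ariasA n : ℂ)) z
  simpa [FormalMultilinearSeries.ofScalarsSum, smul_eq_mul] using this

/-- Near `0` the sum of `Σ A_n zⁿ` IS `log ζ₁(1/(1−z))` (Taylor expansion of an analytic germ).
[cite: AriasDeReyna2011KeiperLi, eq. (4) p.8 and §4 p.11] -/
theorem aSeries_sum_eventuallyEq :
    (FormalMultilinearSeries.ofScalars ℂ (fun n ↦ (ariasA n : ℂ))).sum =ᶠ[𝓝 (0 : ℂ)]
      fun z ↦ Complex.log (riemannZeta₁ (liMap z)) := by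
  obtain ⟨r, hr0, hr⟩ := Metric.isOpen_iff.1
    (isOpen_analyticAt ℂ (fun z ↦ Complex.log (riemannZeta₁ (liMap z)))) 0
    analyticAt_logZetaOne_liMap_zero
  have hd : DifferentiableOn ℂ (fun z ↦ Complex.log (riemannZeta₁ (liMap z))) (Metric.ball 0 r) :=
    fun z hz ↦ (hr hz).differentiableAt.differentiableWithinAt
  filter_upwards [Metric.ball_mem_nhds (0 : ℂ) hr0] with z hz
  have hT := Complex.hasSum_taylorSeries_on_ball hd hz
  rw [aSeries_sum_eq]
  refine HasSum.tsum_eq ?_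
  refine hT.congr_fun fun n ↦ ?_
  rw [ariasA_coe, smul_eq_mul, smul_eq_mul, sub_zero]
  ring

/-- `ζ₁(1/(1−z))` stays in the slit plane near `z = 0` (`ζ₁(1) = 1`). [folklore] -/
private theorem eventually_zetaOne_liMap_mem_slitPlane :
    ∀ᶠ z in 𝓝 (0 : ℂ), riemannZeta₁ (liMap z) ∈ Complex.slitPlane := by
  have hc : ContinuousAt (fun z ↦ riemannZeta₁ (liMap z)) 0 :=
    (differentiable_riemannZeta₁.continuous.continuousAt).comp
      (f := liMap) (analyticAt_liMap zero_ne_one).continuousAt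
  refine hc.eventually_mem (Complex.isOpen_slitPlane.mem_nhds ?_)
  rw [liMap_zero, riemannZeta₁_one]; exact Complex.one_mem_slitPlane

/-- Near `0`: `exp(Σ A_n zⁿ) = ζ₁(1/(1−z))`. [cite: AriasDeReyna2011KeiperLi, proof of Theorem 4.3 p.15] -/
theorem exp_aSeries_sum_eventuallyEq :
    (fun z ↦ Complex.exp ((FormalMultilinearSeries.ofScalars ℂ (fun n ↦ (ariasA n : ℂ))).sum z))
      =ᶠ[𝓝 (0 : ℂ)] fun z ↦ riemannZeta₁ (liMap z) := by
  filter_upwards [aSeries_sum_eventuallyEq, eventually_zetaOne_liMap_mem_slitPlane] with z hz hsl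
  rw [hz, Complex.exp_log (Complex.slitPlane_ne_zero hsl)]

/-- `ζ₁(1/(1−z))` is analytic on the unit disc. [folklore] -/
private theorem analyticOnNhd_zetaOne_liMap :
    AnalyticOnNhd ℂ (fun z ↦ riemannZeta₁ (liMap z)) (Metric.ball 0 1) := by
  intro z hz
  have hz1 : z ≠ 1 := by
    rintro rfl
    simp at hz
  exact (differentiable_riemannZeta₁.analyticAt _).comp (analyticAt_liMap hz1)

/-- **The printed argument of Theorem 4.3 (⟸)**: if `Σ A_n zⁿ` has radius of convergence `≥ 1`, its sum
`g` is holomorphic on the unit disc with `exp g = ζ₁(1/(1−z))` there (identity theorem), so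
`(s−1)ζ(s) ≠ 0` — hence `ξ(s) ≠ 0` — for `Re s > ½`, which is RH (tree `riemannHypothesis_of_liPhi_ne_zero`).
RH-FREE implication. [cite: AriasDeReyna2011KeiperLi, proof of Theorem 4.3 p.15] -/
theorem riemannHypothesis_of_one_le_radius_aSeries
    (h : 1 ≤ (FormalMultilinearSeries.ofScalars ℂ (fun n ↦ (ariasA n : ℂ))).radius) :
    RiemannHypothesis := by
  set P := FormalMultilinearSeries.ofScalars ℂ (fun n ↦ (ariasA n : ℂ)) with hP
  have hpos : 0 < P.radius := lt_of_lt_of_le (by norm_num) h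
  have hA : AnalyticOnNhd ℂ P.sum (Metric.ball 0 1) := by
    intro z hz
    refine (P.hasFPowerSeriesOnBall hpos).analyticAt_of_mem ?_
    have hz' : z ∈ Metric.eball (0 : ℂ) ((1 : NNReal) : ENNReal) := by
      rw [Metric.eball_coe, NNReal.coe_one]; exact hz
    rw [ENNReal.coe_one] at hz'
    exact Metric.eball_subset_eball h hz'
  have hf : AnalyticOnNhd ℂ (fun z ↦ Complex.exp (P.sum z)) (Metric.ball 0 1) :=
    fun z hz ↦ (hA z hz).cexp
  have heq := hf.eqOn_of_preconnected_of_eventuallyEq analyticOnNhd_zetaOne_liMap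
    (convex_ball (0 : ℂ) 1).isPreconnected (Metric.mem_ball_self one_pos) exp_aSeries_sum_eventuallyEq
  refine riemannHypothesis_of_liPhi_ne_zero fun z hz h0 ↦ ?_
  -- `ξ(1/(1−z)) = 0` forces `ζ(1/(1−z)) = 0` with `1/(1−z) ≠ 1`, so `ζ₁(1/(1−z)) = 0 = exp(…)`: absurd
  have h0' : riemannXi (liMap z) = 0 := h0
  obtain ⟨-, h1, hζ⟩ := riemannZeta_eq_zero_of_riemannXi_eq_zero h0'
  have hζ₁ : riemannZeta₁ (liMap z) = 0 := by
    rw [riemannZeta₁_eq_mul h1, hζ, mul_zero]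
  have := heq hz
  simp only [hζ₁] at this
  exact Complex.exp_ne_zero _ this

/-- Square-summable coefficients are bounded, so `Σ A_n zⁿ` has radius `≥ 1`.
[cite: AriasDeReyna2011KeiperLi, proof of Theorem 4.3 p.15] -/
theorem one_le_radius_aSeries_of_summable_sq (h : Summable (fun n ↦ ariasA n ^ 2)) :
    1 ≤ (FormalMultilinearSeries.ofScalars ℂ (fun n ↦ (ariasA n : ℂ))).radius := by
  obtain ⟨C, hC⟩ := (h.tendsto_atTop_zero).bddAbove_range
  have hb : ∀ n, ‖(FormalMultilinearSeries.ofScalars ℂ (fun n ↦ (ariasA n : ℂ))) n‖ * (1 : ℝ) ^ n ≤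
      1 + C := by
    intro n
    rw [FormalMultilinearSeries.ofScalars_norm, Complex.norm_real, Real.norm_eq_abs, one_pow, mul_one]
    have h2 : ariasA n ^ 2 ≤ C := hC ⟨n, rfl⟩
    nlinarith [sq_nonneg (|ariasA n| - 1), sq_abs (ariasA n), abs_nonneg (ariasA n)]
  have := (FormalMultilinearSeries.ofScalars ℂ (fun n ↦ (ariasA n : ℂ))).le_radius_of_bound (1 + C)
    (r := 1) hb
  simpa using this

/-- `ℓ²` is a vector space: `(u_m + v_m) ∈ ℓ²` if `(u_m), (v_m) ∈ ℓ²`. [folklore] -/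
private theorem summable_sq_add {u v : ℕ → ℝ} (hu : Summable (fun m ↦ u m ^ 2))
    (hv : Summable (fun m ↦ v m ^ 2)) : Summable (fun m ↦ (u m + v m) ^ 2) := by
  refine Summable.of_nonneg_of_le (fun m ↦ sq_nonneg _) (fun m ↦ ?_) ((hu.add hv).mul_left 2)
  nlinarith [sq_nonneg (u m - v m)]

/-- A real sequence agreeing with a square-summable one from `m = 1` on is square-summable. [folklore] -/
private theorem summable_sq_of_eqOn_succ {u v : ℕ → ℝ} (hv : Summable (fun m ↦ v m ^ 2))
    (h : ∀ m, 1 ≤ m → u m = v m) : Summable (fun m ↦ u m ^ 2) := by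
  rw [← summable_nat_add_iff 1]
  have e : (fun m ↦ u (m + 1) ^ 2) = fun m ↦ v (m + 1) ^ 2 := by
    funext m; rw [h (m + 1) (by omega)]
  rw [e]
  exact (summable_nat_add_iff 1).2 hv

end AriasDeReyna2011

/-- RH-FREE, PROVED (an implication whose hypothesis is of RH strength) — **[AriasDeReyna2011KeiperLi]
Theorem 4.3 p.15, ⟸**: «If we assume `(A_n) ∈ ℓ²`, then the power series (4) has radius of convergence `1`.
It follows that the function `log{(s−1)ζ(s)}` is analytic on `Re(s) > ½`, and hence the Riemann
Hypothesis is true.»  WHAT THIS IS NOT: the hypothesis is not asserted; nothing here bears on the truth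
of RH. [cite: AriasDeReyna2011KeiperLi, Theorem 4.3 p.15] -/
theorem AriasDeReyna2011_thm43_mpr (h : Summable (fun n ↦ ariasA n ^ 2)) : RiemannHypothesis :=
  AriasDeReyna2011.riemannHypothesis_of_one_le_radius_aSeries
    (AriasDeReyna2011.one_le_radius_aSeries_of_summable_sq h)

/-- RH-FREE, PROVED — **the main theorem of [AriasDeReyna2011KeiperLi] (abstract; §1 p.8), ⟸ half,
unconditionally**: with `y_m` DEFINED by `λ_m = ½(log m + γ − log 2π − 1) + y_m` (Keiper's `λ_m`), if
`(y_m) ∈ ℓ²` then RH.  (By Theorem 4.2, `A_m = y_m + x_m` with `(x_m) ∈ ℓ²`, then Theorem 4.3 ⟸.)  The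
hypothesis is of RH strength and is not asserted. [cite: AriasDeReyna2011KeiperLi, abstract and §1 p.8; Theorem 4.3 p.15] -/
theorem AriasDeReyna2011_thm_main_mpr
    (h : Summable (fun m : ℕ ↦ (keiperLambdaK m -
      (Real.log m / 2 - (Real.log (2 * Real.pi) + 1 - Real.eulerMascheroniConstant) / 2)) ^ 2)) :
    RiemannHypothesis := by
  refine AriasDeReyna2011_thm43_mpr ?_
  have e : (fun n ↦ ariasA n ^ 2) = fun m ↦ ((keiperLambdaK m -
      (Real.log m / 2 - (Real.log (2 * Real.pi) + 1 - Real.eulerMascheroniConstant) / 2)) +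
        AriasDeReyna2011.xSeq m) ^ 2 := by
    funext m
    rw [AriasDeReyna2011.xSeq]
    ring
  rw [e]
  exact AriasDeReyna2011.summable_sq_add h AriasDeReyna2011.summable_xSeq_sq

/-- PROVED MODULO THE NAMED FACT `AriasDeReyna2011_cor31` — **the main theorem of
[AriasDeReyna2011KeiperLi] (abstract; §1 p.8)**: «the Riemann Hypothesis is equivalent to the assertion
`(y_m) ∈ ℓ²` where `y_m` is defined by `λ_m = ½(log m + γ − log(2π) − 1) + y_m`» (Keiper's `λ_m`;
`ℓ²` = square-summable).  ⟹ is Corollary 3.1; ⟸ is `AriasDeReyna2011_thm_main_mpr`.  LABEL: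
RH-EQUIVALENT as printed; neither side is asserted; nothing here bears on the truth of RH.
[cite: AriasDeReyna2011KeiperLi, abstract and §1 p.8] -/
theorem AriasDeReyna2011_thm_main_of_cor31 (h31 : AriasDeReyna2011_cor31) :
    RiemannHypothesis ↔ Summable (fun m : ℕ ↦ (keiperLambdaK m -
      (Real.log m / 2 - (Real.log (2 * Real.pi) + 1 - Real.eulerMascheroniConstant) / 2)) ^ 2) := by
  refine ⟨fun hRH ↦ ?_, AriasDeReyna2011_thm_main_mpr⟩
  obtain ⟨y, hy, hy'⟩ := h31 hRH
  refine AriasDeReyna2011.summable_sq_of_eqOn_succ hy fun m hm ↦ ?_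
  rw [hy' m hm]
  ring

/-- PROVED MODULO THE NAMED FACT `AriasDeReyna2011_cor31` — **[AriasDeReyna2011KeiperLi] Theorem 4.3
p.15**: «The Riemann Hypothesis is equivalent to the assertion that the sequence `(A_n)` is in `ℓ²`.»
(⟹: under RH, `A_n = x_n + y_n` with `(x_n)` from Theorem 4.2 and `(y_n)` from Corollary 3.1; ⟸:
`AriasDeReyna2011_thm43_mpr`, unconditional.)  LABEL: RH-EQUIVALENT as printed; neither side is asserted;
nothing here bears on the truth of RH. [cite: AriasDeReyna2011KeiperLi, Theorem 4.3 p.15] -/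
theorem AriasDeReyna2011_thm43_of_cor31 (h31 : AriasDeReyna2011_cor31) :
    RiemannHypothesis ↔ Summable (fun n ↦ ariasA n ^ 2) := by
  refine ⟨fun hRH ↦ ?_, AriasDeReyna2011_thm43_mpr⟩
  have hy := (AriasDeReyna2011_thm_main_of_cor31 h31).1 hRH
  have e : (fun n ↦ ariasA n ^ 2) = fun m ↦ ((keiperLambdaK m -
      (Real.log m / 2 - (Real.log (2 * Real.pi) + 1 - Real.eulerMascheroniConstant) / 2)) +
        AriasDeReyna2011.xSeq m) ^ 2 := by
    funext m
    rw [AriasDeReyna2011.xSeq]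
    ring
  rw [e]
  exact AriasDeReyna2011.summable_sq_add hy AriasDeReyna2011.summable_xSeq_sq

end Literature.NumberTheory.LFunctions
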